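import Summits.AtomisticToContinuum.BoseEinsteinCondensation.Theorems.BoxLabelAffinity

/-!
# PART B of lens-6 g34 `land/BoxLabelAffinity.lean` (lines 352–602, sha256 f8c3a3ccf8118774…)

§4 the kernel inequalities and §5 the pieces and the deciding kernel (`bec_of_labelAffinity₀` etc.).
(Split for the 400-line rule by prover hand 1, gen 11, decomp-a2c LOW lane; declarations byte-identical; gate-forced deltas: docstrings on the
three measurability lemmas, the §0 rpow conveniences re-derived as local haves; module docstring of record in PART A.)
-/

noncomputable section

open MeasureTheory Filter Set
open scoped ENNReal NNReal BigOperators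

namespace Summit.AtomisticToContinuum.BoseEinsteinCondensation.Theorems.BoxLabelAffinity

open Literature.MathematicalPhysics.QuantumManyBody.BoseGas
open Summit.AtomisticToContinuum.BoseEinsteinCondensation.Theorems.BoxLatticeFSum

variable {n : ℕ}

/-! ### §4  The kernel inequalities -/

/-- Joint measurability of `(x, Y) ↦ Φ(x :: Y)` as an extended real. [folklore] -/
theorem measurable_uncurry_slice {Φ : Config (n + 1) → ℝ} (hΦm : Measurable Φ) :
    Measurable (Function.uncurry fun (x : Space) (Y : Config n) =>
      ENNReal.ofReal (Φ (Matrix.vecCons x Y))) :=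
  (hΦm.comp measurable_vecCons).ennreal_ofReal

/-- Measurability of `sliceSq Φ` for measurable `Φ`. [folklore] -/
theorem measurable_sliceSq {Φ : Config (n + 1) → ℝ} (hΦm : Measurable Φ) :
    Measurable (sliceSq Φ) := by
  have : Measurable fun p : Space × Config n => ENNReal.ofReal (Φ (Matrix.vecCons p.1 p.2)) ^ 2 :=
    (measurable_uncurry_slice hΦm).pow_const 2
  exact this.lintegral_prod_left'

/-- Measurability of the block masses `blockMass L K Φ B` for measurable `Φ`. [folklore] -/
theorem measurable_blockMass (L : ℝ) (K : ℕ) {Φ : Config (n + 1) → ℝ} (hΦm : Measurable Φ)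
    (B : SubIdx K) : Measurable (blockMass L K Φ B) := by
  have : Measurable fun p : Space × Config n => ENNReal.ofReal (Φ (Matrix.vecCons p.1 p.2)) ^ 2 :=
    (measurable_uncurry_slice hΦm).pow_const 2
  exact this.lintegral_prod_left' (μ := volume.restrict (subCell (L / (K : ℝ)) B))

/-- Measurability of the block amplitudes `blockAmp L K Φ B` for measurable `Φ`. [folklore] -/
theorem measurable_blockAmp (L : ℝ) (K : ℕ) {Φ : Config (n + 1) → ℝ} (hΦm : Measurable Φ)
    (B : SubIdx K) : Measurable (blockAmp L K Φ B) := by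
  have : Measurable fun p : Space × Config n => ENNReal.ofReal (Φ (Matrix.vecCons p.1 p.2)) :=
    measurable_uncurry_slice hΦm
  exact (this.lintegral_prod_left' (μ := volume.restrict (subCell (L / (K : ℝ)) B))).const_mul _

/-- **Flat-mode affinity ≤ label affinity**: `BC(u_L) ≤ labelAffinity` (from `m_B ≤ √q_B`) — LAB is
WEAKER than flat-mode condensation (`n(u_L)/N ≤ BC(u_L)` by the tree sandwich). [folklore] -/
theorem flatAffinity_le_labelAffinity {L : ℝ} {K : ℕ} (hL : 0 < L) (hK : 0 < K)
    {Φ : Config (n + 1) → ℝ} (hΦm : Measurable Φ) :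
    flatAffinity L Φ ≤ labelAffinity L K Φ := by
  have rpow_half_sq : ∀ m : ℝ≥0∞, (m ^ 2) ^ (1 / 2 : ℝ) = m := fun m => by
    rw [← ENNReal.rpow_two, ← ENNReal.rpow_mul]; norm_num
  rw [flatAffinity_eq]
  unfold labelAffinity
  refine lintegral_mono fun Y => ?_
  rw [lintegral_flat_slice hL hK hΦm Y, mul_comm]
  gcongr with B hB
  calc blockAmp L K Φ B Y = (blockAmp L K Φ B Y ^ 2) ^ (1 / 2 : ℝ) := (rpow_half_sq _).symm
    _ ≤ blockMass L K Φ B Y ^ (1 / 2 : ℝ) := by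
        gcongr
        exact blockAmp_sq_le_blockMass hL hK hΦm B Y

/-- **THE KERNEL INEQUALITY.** For a normalised nonnegative amplitude,
`labelAffinity ≤ BC(u_L) + blockDepletion^{1/2}`. [folklore] -/
theorem labelAffinity_le_affinity_add {L : ℝ} {K : ℕ} (hL : 0 < L) (hK : 0 < K)
    {Φ : Config (n + 1) → ℝ} (hΦm : Measurable Φ)
    (hΦ1 : ∫⁻ Y : Config n, ∫⁻ x, ENNReal.ofReal (Φ (Matrix.vecCons x Y)) ^ 2 = 1) :
    labelAffinity L K Φ ≤ flatAffinity L Φ + blockDepletion L K Φ ^ (1 / 2 : ℝ) := by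
  have sq_rpow_half : ∀ m : ℝ≥0∞, (m ^ (1 / 2 : ℝ)) ^ 2 = m := fun m => by
    rw [← ENNReal.rpow_two, ← ENNReal.rpow_mul]; norm_num
  have hg : Measurable fun Y => sliceSq Φ Y ^ (1 / 2 : ℝ) := (measurable_sliceSq hΦm).pow_const _
  have h := label_affinity_core (Finset.univ : Finset (SubIdx K)) (volume : Measure (Config n))
    (fun _ => blockWeight K) hg (measurable_blockAmp L K hΦm) (measurable_blockMass L K hΦm)
    (fun B Y => blockAmp_sq_le_blockMass hL hK hΦm B Y)
  have hPhat : ∫⁻ Y : Config n, (sliceSq Φ Y ^ (1 / 2 : ℝ)) ^ 2 = 1 := by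
    simp_rw [sq_rpow_half]; exact hΦ1
  rw [sum_blockWeight_sq hK, hPhat, ENNReal.one_rpow, one_mul, one_mul] at h
  have hBC : ∫⁻ Y : Config n, sliceSq Φ Y ^ (1 / 2 : ℝ) * ∑ B, blockWeight K * blockAmp L K Φ B Y =
      flatAffinity L Φ := by
    rw [flatAffinity_eq]
    exact lintegral_congr fun Y => by rw [lintegral_flat_slice hL hK hΦm Y, mul_comm]
  rw [hBC] at h
  exact h

/-- **Flat-mode occupation from label affinity and block depletion.** If `labelAffinity ≥ c` and
`blockDepletion ≤ s²` for a normalised `Φ ≥ 0` on `N = n+1` particles, then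
`λ_max(γ_Φ) ≥ n(u_L) ≥ N (c − s)²`. [folklore] -/
theorem mul_sq_le_maxOccupation {L : ℝ} {K : ℕ} (hL : 0 < L) (hK : 0 < K)
    {Φ : Config (n + 1) → ℝ} (hΦ0 : 0 ≤ Φ) (hΦm : Measurable Φ)
    (hΦ1 : ∫⁻ Y : Config n, ∫⁻ x, ENNReal.ofReal (Φ (Matrix.vecCons x Y)) ^ 2 = 1)
    {c s : ℝ≥0∞} (hc : c ≤ labelAffinity L K Φ) (hs : blockDepletion L K Φ ≤ s ^ 2) :
    (n + 1 : ℝ≥0∞) * (c - s) ^ 2 ≤ maxOccupation (n + 1) (fun X => (Φ X : ℂ)) := by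
  have rpow_half_sq : ∀ m : ℝ≥0∞, (m ^ 2) ^ (1 / 2 : ℝ) = m := fun m => by
    rw [← ENNReal.rpow_two, ← ENNReal.rpow_mul]; norm_num
  have hdep : blockDepletion L K Φ ^ (1 / 2 : ℝ) ≤ s := by
    calc blockDepletion L K Φ ^ (1 / 2 : ℝ) ≤ (s ^ 2) ^ (1 / 2 : ℝ) := by gcongr
      _ = s := rpow_half_sq s
  have hBC : c - s ≤ flatAffinity L Φ := by
    refine tsub_le_iff_right.2 ?_
    exact hc.trans ((labelAffinity_le_affinity_add hL hK hΦm hΦ1).trans (add_le_add le_rfl hdep))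
  have hocc := bhattacharyya_sq_le_occupation_ae (flatReal_nonneg L) hΦ0 (measurable_flatReal L)
    hΦm (lintegral_flatReal_sq hL) hΦ1
  have hmax : occupation (n + 1) (fun x => ((flatReal L x : ℝ) : ℂ)) (fun X => (Φ X : ℂ)) ≤
      maxOccupation (n + 1) (fun X => (Φ X : ℂ)) := by
    rw [ofReal_flatReal]
    exact occupation_le_maxOccupation _ (aestronglyMeasurable_constantMode L)
      (lintegral_constantMode_sq hL)
  calc (n + 1 : ℝ≥0∞) * (c - s) ^ 2 ≤ (n + 1 : ℝ≥0∞) * flatAffinity L Φ ^ 2 := by gcongr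
    _ ≤ occupation (n + 1) (fun x => ((flatReal L x : ℝ) : ℂ)) (fun X => (Φ X : ℂ)) := by
        rw [flatAffinity_eq]; exact hocc
    _ ≤ maxOccupation (n + 1) (fun X => (Φ X : ℂ)) := hmax

/-! ### §5  The pieces and the deciding kernel -/

/-- **UGS** (support · TAG KNOWN · M) `BoxGroundStateUniqueness`: for `a > 0`, below a density cap the
Dirichlet ground state of `N` bosons in the thermodynamic box `Λ_{(N/ρ)^{1/3}}` is eventually
NONDEGENERATE (a nonnegative minimiser of the closed form exists and ground states agree up to a phase).
Finite `v`: existence by compactness of the resolvent and uniqueness/positivity by positivity improvement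
of `e^{-tH}` [ReedSimonIV1978, Thms XIII.46–47]; hard cores: the same on the (connected, at low density)
hard-sphere configuration region [ReedSimonIV1978, Thm XIII.48].  It is the hypothesis of the tree's
ground-state door, typed there as `HasUniqueGroundState`; this node adds nothing to it.  Why it might fail:
only through the hard-core connectivity step in print-free form.
[cite: ReedSimonIV1978, §XIII.12 Thms XIII.46–XIII.48] -/
@[conjecture] def BoxGroundStateUniqueness : Prop :=
  ∀ v : ℝ → ℝ≥0∞, IsRepulsiveFiniteRange v → 0 < scatteringLength v →
    ∃ ρ₀ : ℝ, 0 < ρ₀ ∧ ∀ ρ : ℝ, 0 < ρ → ρ < ρ₀ →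
      ∀ᶠ N : ℕ in atTop, HasUniqueGroundState v N (sideLength ρ N)

/-- **LOC** (crux · TAG WEAKER · TRUE-type · leaf ATTACKABLE·L) `GroundStateBlockCondensation`: for
`a > 0`, every target depletion `s > 0` and every window constant `A > 0`, below a density cap, eventually
in `N`, the nonnegative ground state `Ψ₀` (when one exists) has BLOCK DEPLETION `≤ s` for every block number
`K` in the GP window `L/K ∈ [A/√ρ, 2A/√ρ]`: all but `sN` particles sit in the flat modes of their own
blocks.  Each block is a GP box of fixed coupling `ρℓ²a ≤ 4A²a` holding `ρℓ³ ≍ A³(ρa³)^{-1/2}a^{-3/2} → ∞`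
particles, where complete BEC is [LS2002] / [LSSY2005, Thm 7.1]; the localisation to blocks of the big box is
Neumann bracketing at precision `A²(ρa³)^{1/2}·ρa N ≪` the GP coercivity gap — the mechanism of
[LSSY2005, Thm 5.1/7.1] and, for growing `A`, of [Junge2026, Cor. 6].  Why it might fail: the transfer from
Neumann-box Gibbs/ground states in print to blocks of the Dirichlet minimiser of the BIG box needs the
localised energy upper bound sector-wise (all particle numbers in a block); hard cores are
[Fournais–Solovej II]-class.  WEAKER than the conjunct: a block-wise phase-disordered condensate
(`Ψ = ⊗_B` condensates with independent phases) satisfies LOC and has `λ_max = O(N/K³)`.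
[cite: LSSY2005, Thm 7.1; Junge2026, Cor. 6] -/
@[conjecture] def GroundStateBlockCondensation : Prop :=
  ∀ v : ℝ → ℝ≥0∞, IsRepulsiveFiniteRange v → 0 < scatteringLength v →
    ∀ s : ℝ, 0 < s → ∀ A : ℝ, 0 < A → ∃ ρ₀ : ℝ, 0 < ρ₀ ∧ ∀ ρ : ℝ, 0 < ρ → ρ < ρ₀ →
      ∀ᶠ n : ℕ in atTop,
        (∃ Ψ₀ : Config (n + 1) → ℝ, (∀ X, 0 ≤ Ψ₀ X) ∧
          IsGroundState v (sideLength ρ (n + 1)) (fun X => (Ψ₀ X : ℂ))) →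
        ∀ K : ℕ, 0 < K → InWindow A ρ (sideLength ρ (n + 1)) K →
          blockDepletion (sideLength ρ (n + 1)) K (groundState v (n + 1) (sideLength ρ (n + 1))) ≤
            ENNReal.ofReal s

/-- **LAB** (crux · DECLARED RESIDUAL · TAG UNDECIDED-DIAGONAL · leaf IDEA-NEEDED)
`GroundStateLabelAffinity`: for `a > 0` there are `c > 0` and a window constant `A > 0` such that, below a
density cap, eventually in `N`, the nonnegative ground state `Ψ₀` (when one exists) has BLOCK-LABEL AFFINITY
`≥ c` for every block number `K` of the GP window: the conditional law of «which of the `K³` blocks holds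
particle 1, given the other `N-1` particles» is, on `P̂`-average, Hellinger-comparable to the uniform law —
`|Ψ₀|²` is quantitatively NON-RIGID (insertion tolerant) at the block scale.  A statement about the
DIAGONAL measure `|Ψ₀|²` ONLY: no off-diagonal / energy / gap quantity occurs.  Implied by flat-mode BEC
(`flatAffinity_le_labelAffinity` + the tree sandwich `n(u_L)/N ≤ BC(u_L)`), and, given LOC, implying it
(`mul_sq_le_maxOccupation`) — so LAB is exactly the residual of BEC modulo local condensation.  Why it might
fail / why undecided: the only route in print to comparability of conditional laws of `|Ψ₀|²` is a Harnack
/ log-concavity estimate for `Ψ₀` uniform in `N` (the solo-blind located wall «lemma M»; Wang's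
dimension-free Harnack needs `Hess(-log Ψ₀) ≥ -O(L⁻²)`); LAB asks much less (block MASSES, averaged `Y`,
Hellinger not sup) but nothing in print controls number RIGIDITY of `|Ψ₀|²` for interacting continuum bosons
(cf. rigidity / tolerance of point processes [GhoshPeres2017], [DHLM2020: DOI 10.1002/cpa.21963]).
[cite: LSSY2005, Thm 7.1 (flat-mode BEC in the GP box ⇒ LAB there); GhoshPeres2017 = DOI 10.1215/00127094-2017-0002 (rigidity and tolerance, the dichotomy LAB quantifies)] -/
@[conjecture] def GroundStateLabelAffinity : Prop :=
  ∀ v : ℝ → ℝ≥0∞, IsRepulsiveFiniteRange v → 0 < scatteringLength v →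
    ∃ c : ℝ, 0 < c ∧ ∃ A : ℝ, 0 < A ∧ ∃ ρ₀ : ℝ, 0 < ρ₀ ∧ ∀ ρ : ℝ, 0 < ρ → ρ < ρ₀ →
      ∀ᶠ n : ℕ in atTop,
        (∃ Ψ₀ : Config (n + 1) → ℝ, (∀ X, 0 ≤ Ψ₀ X) ∧
          IsGroundState v (sideLength ρ (n + 1)) (fun X => (Ψ₀ X : ℂ))) →
        ∀ K : ℕ, 0 < K → InWindow A ρ (sideLength ρ (n + 1)) K →
          ENNReal.ofReal c ≤
            labelAffinity (sideLength ρ (n + 1)) K (groundState v (n + 1) (sideLength ρ (n + 1)))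

/-- **DOOR** (support · TAG PROVED-IN-TREE) `GroundStateDoor`: VERBATIM the statement of the landed
tree theorem `SoloInformed.hasGroundStateBEC_of_groundState_maxOccupation`
(Theorems/SoloInformedGroundStateDoor.lean:272; proof = `condensateNumber = λ_max(γ_{Ψ₀})` under
nondegeneracy, via the tree's trial-state compactness).  It appears as a HYPOTHESIS of the kernel ONLY
because the farm snapshot had that module's import chain (`Literature…BoseGasFaceHardy`) unbuilt at authoring
time (2026-08-31T12:55Z); discharge, once built: `fun v _ hρ _ hc hU hocc =>
SoloInformed.hasGroundStateBEC_of_groundState_maxOccupation v hρ hc hU hocc`.  Not a crux, not counted.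
[cite: LSSY2005, §1.2 (1.17)–(1.19)] -/
@[conjecture] def GroundStateDoor : Prop :=
  ∀ (v : ℝ → ℝ≥0∞) (ρ : ℝ), 0 < ρ → ∀ c : ℝ, 0 < c →
    (∀ᶠ N : ℕ in atTop, HasUniqueGroundState v N (sideLength ρ N)) →
    (∀ᶠ N : ℕ in atTop, ENNReal.ofReal (c * N) ≤
      maxOccupation N (fun X => (groundState v N (sideLength ρ N) X : ℂ))) →
    HasGroundStateBEC v ρ

/-- **The ground-state door IS a tree theorem** (`SoloInformed.hasGroundStateBEC_of_groundState_maxOccupation`,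
`Theorems/SoloInformedGroundStateDoor.lean`, built on the farm 2026-08-31T13:42Z): DOOR is discharged by name.
[cite: LSSY2005, §1.2 (1.19)] -/
theorem groundStateDoor_holds : GroundStateDoor := fun v _ρ hρ _c hc hU hocc =>
  SoloInformed.hasGroundStateBEC_of_groundState_maxOccupation v hρ hc hU hocc

/-- `L_N = (N/ρ)^{1/3} → ∞` along `N = n + 1` (private: the tree twin is `PuffFloorSolidCore.tendsto_sideLength_succ`, gate dedup). [folklore] -/
private theorem tendsto_sideLength_succ_atTop {ρ : ℝ} (hρ : 0 < ρ) :
    Tendsto (fun n : ℕ => sideLength ρ (n + 1)) atTop atTop := by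
  have h : Tendsto (fun N : ℕ => sideLength ρ N) atTop atTop :=
    (tendsto_rpow_atTop (by norm_num : (0 : ℝ) < 1 / 3)).comp
      (tendsto_natCast_atTop_atTop.atTop_div_const hρ)
  exact h.comp (tendsto_add_atTop_nat 1)

/-- **DECIDING KERNEL** (0 sorry): DOOR → UGS → LOC → LAB → the conjunct `BoseEinsteinCondensation`
(`a = 0` by the tree's `zeroScatteringBEC_holds`; `a > 0`: `s = c/2`, an even `K` in the GP window
(`exists_even_inWindow`), `mul_sq_le_maxOccupation` for `Φ = groundState`, and the ground-state door with
constant `c²/4`; DOOR is the tree theorem `SoloInformed.hasGroundStateBEC_of_groundState_maxOccupation`,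
a hypothesis only while its module is unbuilt on the farm). [folklore] -/
theorem bec_of_labelAffinity (hdoor : GroundStateDoor) (hU : BoxGroundStateUniqueness)
    (hloc : GroundStateBlockCondensation) (hlab : GroundStateLabelAffinity) :
    _root_.BoseEinsteinCondensation := by
  intro v hv
  by_cases ha : 0 < scatteringLength v
  swap
  · exact zeroScatteringBEC_holds v hv (le_zero_iff.1 (not_lt.1 ha))
  obtain ⟨c, hc, A, hA, ρ₁, hρ₁, hlab'⟩ := hlab v hv ha
  obtain ⟨ρ₂, hρ₂, hloc'⟩ := hloc v hv ha ((c / 2) ^ 2) (by positivity) A hA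
  obtain ⟨ρ₃, hρ₃, hU'⟩ := hU v hv ha
  refine ⟨min ρ₁ (min ρ₂ ρ₃), lt_min hρ₁ (lt_min hρ₂ hρ₃), fun ρ hρ hρlt => ?_⟩
  have h1 : ρ < ρ₁ := hρlt.trans_le (min_le_left _ _)
  have h2 : ρ < ρ₂ := hρlt.trans_le ((min_le_right _ _).trans (min_le_left _ _))
  have h3 : ρ < ρ₃ := hρlt.trans_le ((min_le_right _ _).trans (min_le_right _ _))
  have hsρ : 0 < Real.sqrt ρ := Real.sqrt_pos.2 hρ
  -- the occupation floor along `N = n + 1`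
  have hev : ∀ᶠ n : ℕ in atTop, ENNReal.ofReal ((c / 2) ^ 2 * ((n + 1 : ℕ) : ℝ)) ≤
      maxOccupation (n + 1) (fun X => (groundState v (n + 1) (sideLength ρ (n + 1)) X : ℂ)) := by
    have hUn : ∀ᶠ n : ℕ in atTop, HasUniqueGroundState v (n + 1) (sideLength ρ (n + 1)) :=
      (tendsto_add_atTop_nat 1).eventually (hU' ρ hρ h3)
    have hLn : ∀ᶠ n : ℕ in atTop, 2 * A / Real.sqrt ρ ≤ sideLength ρ (n + 1) :=
      (tendsto_sideLength_succ_atTop hρ).eventually_ge_atTop _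
    filter_upwards [hlab' ρ hρ h1, hloc' ρ hρ h2, hUn, hLn] with n hlabn hlocn hUn hLn
    set L := sideLength ρ (n + 1) with hLdef
    have hLbig : 2 * A ≤ L * Real.sqrt ρ := (div_le_iff₀ hsρ).1 hLn
    have hL : 0 < L := by
      by_contra h
      nlinarith [hsρ.le, not_lt.1 h, hLbig, hA]
    obtain ⟨K, -, hK, hKw⟩ := exists_even_inWindow hA hρ hLbig
    have hex : ∃ Ψ₀ : Config (n + 1) → ℝ, (∀ X, 0 ≤ Ψ₀ X) ∧
        IsGroundState v L (fun X => (Ψ₀ X : ℂ)) := hUn.1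
    set Φ := groundState v (n + 1) L with hΦdef
    have hΦ0 : 0 ≤ Φ := fun X => groundState_nonneg v (n + 1) L X
    have hΦm : Measurable Φ := measurable_groundState v (n + 1) L
    have hΦ1 : ∫⁻ Y : Config n, ∫⁻ x, ENNReal.ofReal (Φ (Matrix.vecCons x Y)) ^ 2 = 1 := by
      rw [← lintegral_eq_lintegral_lintegral_vecCons (hΦm.ennreal_ofReal.pow_const 2)]
      exact lintegral_groundState_sq hex
    have hs : blockDepletion L K Φ ≤ ENNReal.ofReal (c / 2) ^ 2 := by
      rw [← ENNReal.ofReal_pow (by positivity)]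
      exact hlocn hex K hK hKw
    have key := mul_sq_le_maxOccupation hL hK hΦ0 hΦm hΦ1 (hlabn hex K hK hKw) hs
    have hsub : ENNReal.ofReal c - ENNReal.ofReal (c / 2) = ENNReal.ofReal (c / 2) := by
      rw [← ENNReal.ofReal_sub c (by positivity)]
      congr 1; ring
    rw [hsub] at key
    calc ENNReal.ofReal ((c / 2) ^ 2 * ((n + 1 : ℕ) : ℝ))
        = (n + 1 : ℝ≥0∞) * ENNReal.ofReal (c / 2) ^ 2 := by
          rw [ENNReal.ofReal_mul (by positivity), ENNReal.ofReal_natCast,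
            ENNReal.ofReal_pow (by positivity), mul_comm]
          push_cast; rfl
      _ ≤ maxOccupation (n + 1) (fun X => (Φ X : ℂ)) := key
  -- shift `n + 1 ↦ N` and close through the ground-state door
  have hev' : ∀ᶠ N : ℕ in atTop, ENNReal.ofReal ((c / 2) ^ 2 * (N : ℝ)) ≤
      maxOccupation N (fun X => (groundState v N (sideLength ρ N) X : ℂ)) := by
    rw [← Filter.map_add_atTop_eq_nat 1, Filter.eventually_map]
    exact hev
  exact hdoor v ρ hρ ((c / 2) ^ 2) (by positivity) (hU' ρ hρ h3) hev'

/-- **DECIDING KERNEL, door discharged** (0 sorry, no hypothesis beyond the three pieces):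
UGS → LOC → LAB → `BoseEinsteinCondensation`. [folklore] -/
theorem bec_of_labelAffinity₀ (hU : BoxGroundStateUniqueness) (hloc : GroundStateBlockCondensation)
    (hlab : GroundStateLabelAffinity) : _root_.BoseEinsteinCondensation :=
  bec_of_labelAffinity groundStateDoor_holds hU hloc hlab


end Summit.AtomisticToContinuum.BoseEinsteinCondensation.Theorems.BoxLabelAffinity
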